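import Literature.NumberTheory.EllipticCurves.CaiShuTian2017.CubeSumTwicePrimes
import Literature.NumberTheory.EllipticCurves.BSDRootNumberSmallConductorAssemblyProofs
import Literature.NumberTheory.EllipticCurves.ComplexMultiplication
import Literature.NumberTheory.EllipticCurves.ComplexMultiplicationHasCMProofs
import HarnessLib

/-!
# Cai–Shu–Tian 2017, Thm. 1.2 — PROOFS ONLY: the combination step with Burungale–Flach 2024 giving Miller's `BSD(C_{2p*}, ℓ)` for every prime `ℓ ∤ 2p`

Companion of `CaiShuTian2017/CubeSumTwicePrimes.lean` (the named facts `thm11_…`, `thm12_…`, AS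
PRINTED; cell `bsd-print-cf2`, typer `ty1`). No definition, no named fact, nothing asserted here:
only theorems PROVED from the tree.

* `isCubeSum_two`, `isCubeSum_mul_pow_three` — API of the printed notion `IsCubeSum`.
* `cubeSumTwoModel_c₄`, `c₄_eq_zero_of_variableChange_eq_cubeSumTwoModel`,
  `hasCM_of_variableChange_eq_cubeSumTwoModel` — Kezuka–Li's model `y² = x³ − 27p^{2j}` of
  `x³ + y³ = 2p^j` has `c₄ = 0`, so every `ℚ`-isomorphic curve has `j = 0` and CM by `ℤ[ω]`.
* `bsdp_of_shaAn_mul_of_bsdTriple` — THE COMBINATION STEP: for elliptic `A`, `B` over `ℚ`, a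
  product identity `#Ш(B)_an · #Ш(A)_an = q ∈ ℚ`, `ord_ℓ q = ord_ℓ(#Ш(B)[ℓ^∞] · #Ш(A)[ℓ^∞])`, plus
  RANK ∧ SHAFIN ∧ LEAD for `A` (so `#Ш(A)_an = #Ш(A) ≠ 0`), `rk B = r_an B` and `Ш(B)` finite give
  Miller's `BSD(B, ℓ)` (the same mechanism as `HuShuYin2019.bsdp_three_of_threePart_product`, here
  for any prime `ℓ` and without a printed non-vanishing input: the case `q = 0` forces
  `#Ш(B)[ℓ^∞] = 1`).
* `bsdp_of_thm12_two_mod_nine` / `bsdp_of_thm12_five_mod_nine` — Thm. 1.2 + the tree's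
  Burungale–Flach fact `bsdTriple_of_hasCM_of_L_one_ne_zero` (rank-zero CM partner) + modularity
  `hasEntireLFunction_rat` (`r_an = 0 ⇒ L(1) ≠ 0`) ⇒ `r_an = 1 ∧ BSD(W, ℓ)` for the rank-one curve
  `C_{2p}` (`p ≡ 2 mod 9`) resp. `C_{2p²}` (`p ≡ 5 mod 9`) and every prime `ℓ ∤ 2p`. In PARTITION
  currency these pairs `(W, ℓ)` are CM rank-one pairs at odd `ℓ ≠ p`: `ℓ = 3` (ramified in
  `ℚ(√−3)`, additive — CornerF ramified, cf. `KezukaLi2020.bsdp_three_of_cor12`) and odd good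
  `ℓ` (rows C10 / C17); the leaf CornerF @ 2 is NOT touched (`ℓ = 2` is excluded in print).

## References
* [CaiShuTian2017] L. Cai, J. Shu, Y. Tian, Amer. J. Math. 139 (2017) 785–816, Thm. 1.2
  (arXiv:1412.1950 chunk p0002 L16–L23).
* [KezukaLi2020] Y. Kezuka, Y. Li, Doc. Math. 25 (2020), p. 2116, (4.1) p. 2139.
* [BurungaleFlach2024] A. Burungale, M. Flach, Camb. J. Math. 12 (2024), Cor. 2.
* [Miller2011LMS] R. L. Miller, LMS J. Comput. Math. 14 (2011), §1 and Def. 1.1.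
-/

noncomputable section

open scoped Classical

open WeierstrassCurve Literature.NumberTheory.EllipticCurves
  Literature.NumberTheory.EllipticCurves.KezukaLi2020

namespace Literature.NumberTheory.EllipticCurves.CaiShuTian2017

/-! ### §1. API of the vocabulary -/

/-- `2 = 1³ + 1³` is a cube sum in the printed sense (both cubes nonzero).
[cite: CaiShuTian2017, §1 (arXiv:1412.1950 chunk p0002 L3: the definition of a cube sum)] -/
theorem isCubeSum_two : IsCubeSum 2 :=
  ⟨two_ne_zero, 1, 1, one_ne_zero, one_ne_zero, by norm_num⟩

/-- Cube sums are stable under multiplication by nonzero rational cubes: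
`a³ + b³ = r ⇒ (ac)³ + (bc)³ = r c³` (so "`2p⁻¹` is a cube sum" ⟺ "`2p²` is a cube sum"; the
source's `p* = p^{±1}` convention). [cite: CaiShuTian2017, §1 (arXiv chunk p0002 L3, L10)] -/
theorem isCubeSum_mul_pow_three {r : ℚ} (h : IsCubeSum r) {c : ℚ} (hc : c ≠ 0) :
    IsCubeSum (r * c ^ 3) := by
  obtain ⟨hr, a, b, ha, hb, hab⟩ := h
  refine ⟨mul_ne_zero hr (pow_ne_zero 3 hc), a * c, b * c, mul_ne_zero ha hc, mul_ne_zero hb hc,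
    ?_⟩
  rw [← hab]
  ring

/-- `c₄ = 0` for Kezuka–Li's model `y² = x³ − 27 p^{2j}` of `x³ + y³ = 2p^j` (all of `a₁, a₂, a₃,
a₄` vanish). [cite: KezukaLi2020, (4.1) (p. 2139)] -/
theorem cubeSumTwoModel_c₄ (p j : ℕ) : (cubeSumTwoModel p j).c₄ = 0 := by
  simp [cubeSumTwoModel, WeierstrassCurve.c₄, WeierstrassCurve.b₂, WeierstrassCurve.b₄]

/-- A curve `ℚ`-isomorphic to `y² = x³ − 27 p^{2j}` has `c₄ = 0` (`c₄` scales by `u⁻⁴`).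
[cite: KezukaLi2020, (4.1) (p. 2139)] -/
theorem c₄_eq_zero_of_variableChange_eq_cubeSumTwoModel {W : WeierstrassCurve ℚ} {p j : ℕ}
    (hW : ∃ C : VariableChange ℚ, C • W = cubeSumTwoModel p j) : W.c₄ = 0 := by
  obtain ⟨C, hC⟩ := hW
  have h : (C • W).c₄ = ((C.u⁻¹ : ℚˣ) : ℚ) ^ 4 * W.c₄ := WeierstrassCurve.variableChange_c₄ W C
  rw [hC, cubeSumTwoModel_c₄] at h
  have hu : ((C.u⁻¹ : ℚˣ) : ℚ) ^ 4 ≠ 0 := pow_ne_zero _ (Units.ne_zero _)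
  rcases mul_eq_zero.mp h.symm with h0 | h0
  · exact absurd h0 hu
  · exact h0

/-- A curve `ℚ`-isomorphic to `y² = x³ − 27 p^{2j}` has `j = 0`, hence (geometric) complex
multiplication by `ℤ[ω]` (tree theorem `WeierstrassCurve.hasCM_of_j_eq_zero`; "`C_n` has complex
multiplication by the integer ring `𝒪_K` of `K = ℚ(√−3)`", Kezuka–Li p. 2116).
[cite: KezukaLi2020, p. 2116 and (4.1) (p. 2139)] -/
theorem hasCM_of_variableChange_eq_cubeSumTwoModel {W : WeierstrassCurve ℚ} [W.IsElliptic]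
    {p j : ℕ} (hW : ∃ C : VariableChange ℚ, C • W = cubeSumTwoModel p j) : W.HasCM :=
  WeierstrassCurve.hasCM_of_j_eq_zero W
    (W.j_eq_zero (c₄_eq_zero_of_variableChange_eq_cubeSumTwoModel hW))

/-! ### §3. Consequences PROVED (bookkeeping in Miller's `BSD(E, ℓ)` currency) -/

/-- **The combination step (PROVED): a product identity at `ℓ` for `B × A` plus RANK ∧ SHAFIN ∧
LEAD for `A` gives Miller's `BSD(B, ℓ)`.** Data: `A`, `B` elliptic over `ℚ`; `A.BSDTriple` (so
`#Ш(A)_an = #Ш(A) ≠ 0`, `bsdLeadingTermFormula_iff_shaAn_eq'`, and `BSD(A, ℓ)`,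
`forall_bsdp_of_bsdTriple'`); `rk B = r_an(B)`; `Ш(B)` finite; `#Ш(B)_an · #Ш(A)_an = q ∈ ℚ` with
`ord_ℓ q = ord_ℓ (#Ш(B)[ℓ^∞] · #Ш(A)[ℓ^∞])`. Then `#Ш(B)_an = q / #Ш(A)` is rational and
`ord_ℓ #Ш(B)_an = ord_ℓ #Ш(B)[ℓ^∞]`. [cite: Miller2011LMS, §1 and Def. 1.1] -/
theorem bsdp_of_shaAn_mul_of_bsdTriple (A B : WeierstrassCurve ℚ) [A.IsElliptic] [B.IsElliptic]
    (hT : A.BSDTriple) (hB : B.mordellWeilRank = B.analyticRank) (hBfin : Finite B.sha)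
    {ℓ : ℕ} (hℓ : ℓ.Prime) {q : ℚ} (hq : shaAn B * shaAn A = (q : ℂ))
    (hv : padicValRat ℓ q =
      padicValNat ℓ (Nat.card (AddCommGroup.primaryComponent B.sha ℓ) *
        Nat.card (AddCommGroup.primaryComponent A.sha ℓ))) :
    BSDp B ℓ := by
  haveI : Fact ℓ.Prime := ⟨hℓ⟩
  have hAfin : A.ShaFinite := hT.2.1
  have hlead : A.BSDLeadingTermFormula := hT.2.2
  haveI : Finite A.sha := hAfin
  haveI : Finite B.sha := hBfin
  haveI hBfinℓ : Finite (AddCommGroup.primaryComponent B.sha ℓ) :=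
    Finite.of_injective _ Subtype.val_injective
  haveI hAfinℓ : Finite (AddCommGroup.primaryComponent A.sha ℓ) :=
    Finite.of_injective _ Subtype.val_injective
  have hA : shaAn A = (A.shaOrder : ℂ) := (bsdLeadingTermFormula_iff_shaAn_eq' A).1 hlead
  have hA0 : (A.shaOrder : ℚ) ≠ 0 := by
    exact_mod_cast (WeierstrassCurve.shaOrder_pos (W := A) hAfin).ne'
  obtain ⟨-, -, qA, hqA, hvA⟩ := forall_bsdp_of_bsdTriple' A hT ℓ hℓ
  have hqA' : qA = (A.shaOrder : ℚ) := by exact_mod_cast hqA.symm.trans hA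
  have hqA0 : qA ≠ 0 := by
    rw [hqA']
    exact hA0
  have hb0 : Nat.card (AddCommGroup.primaryComponent B.sha ℓ) ≠ 0 := Nat.card_pos.ne'
  have ha0 : Nat.card (AddCommGroup.primaryComponent A.sha ℓ) ≠ 0 := Nat.card_pos.ne'
  refine ⟨hB, hBfinℓ, q / qA, ?_, ?_⟩
  · have hqAC : (qA : ℂ) ≠ 0 := by exact_mod_cast hqA0
    rw [Rat.cast_div, eq_div_iff hqAC, ← hqA]
    exact hq
  · rw [padicValNat.mul hb0 ha0, Nat.cast_add] at hv
    by_cases hq0 : q = 0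
    · subst hq0
      rw [padicValRat.zero] at hv
      rw [zero_div, padicValRat.zero]
      omega
    · rw [padicValRat.div hq0 hqA0, hv, hvA]
      ring

/-- **Thm. 1.2 (`p ≡ 2 mod 9`) + Burungale–Flach 2024 ⇒ `BSD(C_{2p}, ℓ)` for every prime
`ℓ ∤ 2p`**, for any globally minimal model `W₁` of `x³ + y³ = 2p` (the rank-one curve, `r_an = 1`),
given a globally minimal model `W₂` of the rank-zero partner `x³ + y³ = 2p²` (which exists for every
curve over `ℚ`; supplying it is the consumer's certificate). Standing named facts: `hCM0`
(Burungale–Flach Cor. 2, tree form `bsdTriple_of_hasCM_of_L_one_ne_zero`), `hmod` (modularity,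
for `r_an(W₂) = 0 ⇒ L(W₂, 1) ≠ 0`). In particular `BSD(C_{2p}, 3)` (cf. Kezuka–Li 2020 Cor. 1.2 (1))
and `BSD(C_{2p}, ℓ)` at every odd good prime `ℓ ≠ p`; NOT `ℓ = 2`, NOT `ℓ = p`.
[cite: CaiShuTian2017, Thm. 1.2 (arXiv chunk p0002 L16–L23)] [cite: BurungaleFlach2024, Cor. 2] [cite: Miller2011LMS, Def. 1.1] -/
theorem bsdp_of_thm12_two_mod_nine (h : thm12_bsd_cubeSum_twicePrime)
    (hCM0 : bsdTriple_of_hasCM_of_L_one_ne_zero) (hmod : hasEntireLFunction_rat)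
    {p : ℕ} (hp : p.Prime) (hp2 : p ≠ 2) (h9 : p % 9 = 2)
    (W₁ W₂ : WeierstrassCurve ℚ) [W₁.IsElliptic] [W₁.IsGloballyMinimal] [W₂.IsElliptic]
    [W₂.IsGloballyMinimal] (hW₁ : ∃ C : VariableChange ℚ, C • W₁ = cubeSumTwoModel p 1)
    (hW₂ : ∃ C : VariableChange ℚ, C • W₂ = cubeSumTwoModel p 2)
    {ℓ : ℕ} (hℓ : ℓ.Prime) (hℓ2p : ¬ ℓ ∣ 2 * p) :
    W₁.analyticRank = 1 ∧ BSDp W₁ ℓ := by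
  obtain ⟨-, -, h2, -, hfin₁, -, hall⟩ := h p hp hp2 (Or.inl h9) W₁ W₂ hW₁ hW₂
  obtain ⟨har₁, hrk₁, har₂, -⟩ := h2 h9
  obtain ⟨q, hq, hv⟩ := hall ℓ hℓ hℓ2p
  have hcm : W₂.HasCM := hasCM_of_variableChange_eq_cubeSumTwoModel hW₂
  have hL : W₂.entireLFunction 1 ≠ 0 := (W₂.analyticRank_eq_zero_iff_holds (hmod W₂)).1 har₂
  have hT : W₂.BSDTriple := hCM0 W₂ hcm hL
  exact ⟨har₁, bsdp_of_shaAn_mul_of_bsdTriple W₂ W₁ hT (by rw [hrk₁, har₁]) hfin₁ hℓ hq hv⟩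

/-- **Thm. 1.2 (`p ≡ 5 mod 9`) + Burungale–Flach 2024 ⇒ `BSD(C_{2p²}, ℓ)` for every prime
`ℓ ∤ 2p`**, for any globally minimal model `W₂` of `x³ + y³ = 2p²` (`≅ x³ + y³ = 2p⁻¹`, the rank-one
curve), given a globally minimal model `W₁` of the rank-zero partner `x³ + y³ = 2p`. Standing named
facts as in `bsdp_of_thm12_two_mod_nine`. NOT `ℓ = 2`, NOT `ℓ = p`.
[cite: CaiShuTian2017, Thm. 1.2 (arXiv chunk p0002 L16–L23)] [cite: BurungaleFlach2024, Cor. 2] [cite: Miller2011LMS, Def. 1.1] -/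
theorem bsdp_of_thm12_five_mod_nine (h : thm12_bsd_cubeSum_twicePrime)
    (hCM0 : bsdTriple_of_hasCM_of_L_one_ne_zero) (hmod : hasEntireLFunction_rat)
    {p : ℕ} (hp : p.Prime) (h9 : p % 9 = 5)
    (W₁ W₂ : WeierstrassCurve ℚ) [W₁.IsElliptic] [W₁.IsGloballyMinimal] [W₂.IsElliptic]
    [W₂.IsGloballyMinimal] (hW₁ : ∃ C : VariableChange ℚ, C • W₁ = cubeSumTwoModel p 1)
    (hW₂ : ∃ C : VariableChange ℚ, C • W₂ = cubeSumTwoModel p 2)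
    {ℓ : ℕ} (hℓ : ℓ.Prime) (hℓ2p : ¬ ℓ ∣ 2 * p) :
    W₂.analyticRank = 1 ∧ BSDp W₂ ℓ := by
  have hp2 : p ≠ 2 := by
    rintro rfl
    norm_num at h9
  obtain ⟨-, -, -, h5, -, hfin₂, hall⟩ := h p hp hp2 (Or.inr h9) W₁ W₂ hW₁ hW₂
  obtain ⟨har₂, hrk₂, har₁, -⟩ := h5 h9
  obtain ⟨q, hq, hv⟩ := hall ℓ hℓ hℓ2p
  have hcm : W₁.HasCM := hasCM_of_variableChange_eq_cubeSumTwoModel hW₁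
  have hL : W₁.entireLFunction 1 ≠ 0 := (W₁.analyticRank_eq_zero_iff_holds (hmod W₁)).1 har₁
  have hT : W₁.BSDTriple := hCM0 W₁ hcm hL
  rw [mul_comm] at hq
  rw [Nat.mul_comm] at hv
  exact ⟨har₂, bsdp_of_shaAn_mul_of_bsdTriple W₁ W₂ hT (by rw [hrk₂, har₂]) hfin₂ hℓ hq hv⟩

end Literature.NumberTheory.EllipticCurves.CaiShuTian2017
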